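import Literature.Computability.Complexity.KarpCliqueNP
import Literature.Computability.Complexity.SharpPClosure

/-!
# PneNP / PhaseTwins — `HardcoreCountSharpP` (stmt-PneNP-2722), part 2: the `P` tests on `⟨code, witness⟩`

Route `PneNP/PhaseTwins`, support item stmt-PneNP-2722 (`HardcoreCountSharpP`). A string
`W = ⟨y, z⟩` pairs a graph code `y = ⟨nc, bits⟩` (after canonicalisation, part 1, `y` is either the
code `encodingGraph.encode ⟨n, G⟩ = ⟨encodeNat n, adjBits n G⟩` or fails the header test) with a
witness `z ∈ {0,1}ⁿ`, the characteristic vector of a vertex set `S_z`. This file assembles, from the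
tree's `FP` bricks (no machine is written; the pattern of `KarpCliqueNP.lean`, whose instance format
`⟨⟨nc, bits⟩, kc⟩` is literally `W` with `kc := z`), the one-bit test `testT Δ` deciding

* the header `|bits| = ⟦nc⟧²` (`CliqueNP.hdrT`, reused as is),
* the degree bound: every row `i < |z|` of the bit matrix (row length `|z|`) has `< Δ + 1` ones
  (`degT`: an index-all fold `Brick.allIdxFn` of `popCountFn`/`ltFn` over the rows cut out by
  `takeFn`/`dropFn`/`umulFn`),
* independence: for every flat index `t < |bits|`, not (`z (t / |z|)` and `z (t % |z|)` and `bits t`)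
  (`indT`, an index-all fold as `CliqueNP.prT` with the adjacency bit negated),

and its meaning on `⟨encodingGraph.encode ⟨n, G⟩, z⟩` for `|z| = n` (**`mem_testLang_encode_iff`**):
`G.maxDegree ≤ Δ` and `S_z` is an independent set of `G`. The language `testLang Δ` is in `P`
(`testLang_mem_P`). Also here: the three length functions of the counting assembly — `gLen y = 1ⁿ`
(the witness length, `binToUnaryFn`), `gP ⟨y, z⟩ = 1^{#1(z)}` and `gQ ⟨y, z⟩ = z ⇂ #1(z)` (of length
`n - #1(z)`), all in `FP`.

References: R. M. Karp, *Reducibility among combinatorial problems* (1972), §3 (graph encodings);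
S. Arora, B. Barak, *Computational Complexity: A Modern Approach* (2009), Def. 17.2, §1.3.
-/

noncomputable section

-- `Summit.PneNP.PneNP.…` duplicates `PneNP` BY DESIGN (single-problem summit, D-0017 layout).
set_option linter.dupNamespace false

namespace Summit.PneNP.PneNP.Theorems

open Literature.Computability.Complexity Computability Brick OracleCompose Plumb HashBricks Polynomial Finset

namespace HardcoreSharpP

/-! ### The degree test -/

/-- On `⟨W, u⟩`, `W = ⟨⟨nc, bits⟩, z⟩`: the unary witness length `1^{|z|}`. [folklore] -/
def tN : List Bool → List Bool := onesFn ∘ sndF ∘ fstF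
/-- On `⟨W, 1ⁱ⟩`: row `i` of the bit matrix with row length `|z|`, `(bits ⇂ i |z|) ↾ |z|`. [folklore] -/
def tRow : List Bool → List Bool :=
  takeFn ∘ fanoutFn tN (dropFn ∘ fanoutFn (umulFn ∘ fanoutFn sndF tN) (sndF ∘ fstF ∘ fstF))
/-- **The degree piece** on `⟨W, 1ⁱ⟩`: `[#1(row i) < Δ + 1]`. [cite: AroraBarak2009, §1.3] -/
def degPiece (Δ : ℕ) : List Bool → List Bool := ltFn ∘ fanoutFn (popCountFn ∘ tRow) fun _ => encodeNat (Δ + 1)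
/-- **The degree test** `degT Δ W = [∀ i < |z|, #1(row i) < Δ + 1]` (index-all fold, yardstick `z`).
[cite: AroraBarak2009, §1.3 (bounded loops)] -/
def degT (Δ : ℕ) : List Bool → List Bool := allIdxFn sndF (degPiece Δ)

/-- `tN ∈ FP`. [folklore] -/
theorem tN_mem_FP : tN ∈ FP := comp_mem_FP onesFn_mem_FP (comp_mem_FP sndF_mem_FP fstF_mem_FP)
/-- `tRow ∈ FP`. [folklore] -/
theorem tRow_mem_FP : tRow ∈ FP :=
  comp_mem_FP takeFn_mem_FP (fanoutFn_mem_FP tN_mem_FP (comp_mem_FP dropFn_mem_FP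
    (fanoutFn_mem_FP (comp_mem_FP umulFn_mem_FP (fanoutFn_mem_FP sndF_mem_FP tN_mem_FP))
      (comp_mem_FP sndF_mem_FP (comp_mem_FP fstF_mem_FP fstF_mem_FP)))))
/-- `degPiece Δ ∈ FP`. [cite: AroraBarak2009, §1.3] -/
theorem degPiece_mem_FP (Δ : ℕ) : degPiece Δ ∈ FP :=
  comp_mem_FP ltFn_mem_FP (fanoutFn_mem_FP (comp_mem_FP popCountFn_mem_FP tRow_mem_FP) (const_mem_FP _))
/-- `degPiece Δ` is one-bit. [folklore] -/
theorem oneBit_degPiece (Δ : ℕ) : OneBit (degPiece Δ) := oneBit_ltFn.comp _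
/-- The yardstick `z` fits: `|sndF W| ≤ |W|`. [folklore] -/
theorem length_sndF_le (W : List Bool) : (sndF W).length ≤ W.length := by
  have := length_fstF_sndF_le W; omega
/-- `degT Δ ∈ FP`. [cite: AroraBarak2009, §1.3 (bounded loops)] -/
theorem degT_mem_FP (Δ : ℕ) : degT Δ ∈ FP := allIdxFn_mem_FP sndF_mem_FP (degPiece_mem_FP Δ) (oneBit_degPiece Δ)
/-- `degT Δ` is one-bit. [folklore] -/
theorem oneBit_degT (Δ : ℕ) : OneBit (degT Δ) := oneBit_allIdxFn (oneBit_degPiece Δ) length_sndF_le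

/-- Row `i` of a bit matrix with row length `n`. [folklore] -/
def rowOf (n i : ℕ) (bits : List Bool) : List Bool := (bits.drop (i * n)).take n

/-- `onesFn z = 1^{|z|}`. [folklore] -/
theorem onesFn_eq_ones (z : List Bool) : onesFn z = ones z.length := onesFn_eq_replicate z

/-- **Value of the degree piece** on `⟨⟨⟨nc, bits⟩, z⟩, 1ⁱ⟩`. [folklore] -/
theorem degPiece_apply (Δ : ℕ) (nc bits z : List Bool) (i : ℕ) :
    degPiece Δ (boolPair (boolPair (boolPair nc bits) z) (ones i)) =
      [decide ((rowOf z.length i bits).count true < Δ + 1)] := by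
  set W := boolPair (boolPair nc bits) z with hW
  have hN : tN (boolPair W (ones i)) = ones z.length := by
    rw [tN, Function.comp_apply, Function.comp_apply, fstF_boolPair, hW, sndF_boolPair, onesFn_eq_ones]
  have hrow : tRow (boolPair W (ones i)) = rowOf z.length i bits := by
    rw [tRow, Function.comp_apply, fanoutFn_apply, hN, Function.comp_apply, fanoutFn_apply, Function.comp_apply,
      fanoutFn_apply, sndF_boolPair, hN, umulFn_boolPair, Function.comp_apply, Function.comp_apply, fstF_boolPair, hW,
      fstF_boolPair, sndF_boolPair, dropFn_boolPair, List.length_replicate, takeFn_boolPair, List.length_replicate]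
    rfl
  rw [degPiece, Function.comp_apply, fanoutFn_apply, Function.comp_apply, hrow, popCountFn_apply, ltFn_boolPair,
    bitsToNat_encodeNat, bitsToNat_encodeNat]

/-- **Value of the degree test** on `⟨⟨nc, bits⟩, z⟩`. [folklore] -/
theorem degT_apply (Δ : ℕ) (nc bits z : List Bool) :
    degT Δ (boolPair (boolPair nc bits) z) = [decide (∀ i < z.length, (rowOf z.length i bits).count true < Δ + 1)] := by
  rw [degT, allIdxFn_apply (oneBit_degPiece Δ) (length_sndF_le _)]
  refine congrArg (fun b => [b]) (Bool.decide_congr ?_)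
  rw [sndF_boolPair]
  simp only [degPiece_apply, List.cons.injEq, and_true, decide_eq_true_eq]

/-! ### The independence test -/

/-- On `⟨W, 1ᵗ⟩`: `⟨1^{t / |z|}, 1^{t % |z|}⟩`. [folklore] -/
def iIJ : List Bool → List Bool := divModFn ∘ fanoutFn tN sndF
/-- On `⟨W, 1ᵗ⟩`: the witness bit `[z (t / |z|)]` (default `false`). [folklore] -/
def iZI : List Bool → List Bool := headBitFn ∘ dropFn ∘ fanoutFn (fstF ∘ iIJ) (sndF ∘ fstF)
/-- On `⟨W, 1ᵗ⟩`: the witness bit `[z (t % |z|)]` (default `false`). [folklore] -/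
def iZJ : List Bool → List Bool := headBitFn ∘ dropFn ∘ fanoutFn (sndF ∘ iIJ) (sndF ∘ fstF)
/-- On `⟨W, 1ᵗ⟩`: the adjacency bit `[bits t]`. [folklore] -/
def iB : List Bool → List Bool := headBitFn ∘ bitAtFn ∘ fanoutFn sndF (sndF ∘ fstF ∘ fstF)
/-- **The independence piece** on `⟨W, 1ᵗ⟩`: `¬ (z (t / |z|) ∧ z (t % |z|) ∧ bits t)` — two chosen vertices
are not adjacent. [cite: Karp1972, §3] -/
def indPiece : List Bool → List Bool := notFn (andFn iZI (andFn iZJ iB))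
/-- **The independence test** `indT W = [∀ t < |bits|, indPiece ⟨W, 1ᵗ⟩ = [1]]` (index-all fold, yardstick the
bit field). [cite: AroraBarak2009, §1.3 (bounded loops)] -/
def indT : List Bool → List Bool := allIdxFn (sndF ∘ fstF) indPiece

/-- `iIJ ∈ FP`. [folklore] -/
theorem iIJ_mem_FP : iIJ ∈ FP := comp_mem_FP divModFn_mem_FP (fanoutFn_mem_FP tN_mem_FP sndF_mem_FP)
/-- `iZI ∈ FP`. [folklore] -/
theorem iZI_mem_FP : iZI ∈ FP :=
  comp_mem_FP headBitFn_mem_FP (comp_mem_FP dropFn_mem_FP (fanoutFn_mem_FP (comp_mem_FP fstF_mem_FP iIJ_mem_FP)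
    (comp_mem_FP sndF_mem_FP fstF_mem_FP)))
/-- `iZJ ∈ FP`. [folklore] -/
theorem iZJ_mem_FP : iZJ ∈ FP :=
  comp_mem_FP headBitFn_mem_FP (comp_mem_FP dropFn_mem_FP (fanoutFn_mem_FP (comp_mem_FP sndF_mem_FP iIJ_mem_FP)
    (comp_mem_FP sndF_mem_FP fstF_mem_FP)))
/-- `iB ∈ FP`. [folklore] -/
theorem iB_mem_FP : iB ∈ FP :=
  comp_mem_FP headBitFn_mem_FP (comp_mem_FP bitAtFn_mem_FP (fanoutFn_mem_FP sndF_mem_FP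
    (comp_mem_FP sndF_mem_FP (comp_mem_FP fstF_mem_FP fstF_mem_FP))))
/-- `indPiece ∈ FP`. [cite: AroraBarak2009, §1.3] -/
theorem indPiece_mem_FP : indPiece ∈ FP := notFn_mem_FP (andFn_mem_FP iZI_mem_FP (andFn_mem_FP iZJ_mem_FP iB_mem_FP))
/-- `iZI` is one-bit. [folklore] -/
theorem oneBit_iZI : OneBit iZI := oneBit_headBitFn.comp _
/-- `iZJ` is one-bit. [folklore] -/
theorem oneBit_iZJ : OneBit iZJ := oneBit_headBitFn.comp _
/-- `iB` is one-bit. [folklore] -/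
theorem oneBit_iB : OneBit iB := oneBit_headBitFn.comp _
/-- `indPiece` is one-bit. [folklore] -/
theorem oneBit_indPiece : OneBit indPiece := oneBit_notFn (oneBit_andFn oneBit_iZI (oneBit_andFn oneBit_iZJ oneBit_iB))
/-- The yardstick `bits` fits: `|sndF (fstF W)| ≤ |W|`. [folklore] -/
theorem length_sndF_fstF_le (W : List Bool) : ((sndF ∘ fstF) W).length ≤ W.length := by
  have h1 := length_fstF_sndF_le W
  have h2 := length_fstF_sndF_le (fstF W)
  rw [Function.comp_apply]; omega
/-- `indT ∈ FP`. [cite: AroraBarak2009, §1.3 (bounded loops)] -/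
theorem indT_mem_FP : indT ∈ FP := allIdxFn_mem_FP (comp_mem_FP sndF_mem_FP fstF_mem_FP) indPiece_mem_FP oneBit_indPiece
/-- `indT` is one-bit. [folklore] -/
theorem oneBit_indT : OneBit indT := oneBit_allIdxFn oneBit_indPiece length_sndF_fstF_le

/-- The Boolean decided by the independence piece at the flat index `t`. [folklore] -/
def indAtB (bits z : List Bool) (t : ℕ) : Bool :=
  !(z.getD (t / z.length) false && (z.getD (t % z.length) false && bits.getD t false))

/-- **Value of the independence piece** on `⟨⟨⟨nc, bits⟩, z⟩, 1ᵗ⟩`. [folklore] -/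
theorem indPiece_apply (nc bits z : List Bool) (t : ℕ) :
    indPiece (boolPair (boolPair (boolPair nc bits) z) (ones t)) = [indAtB bits z t] := by
  set W := boolPair (boolPair nc bits) z with hW
  have hN : tN (boolPair W (ones t)) = ones z.length := by
    rw [tN, Function.comp_apply, Function.comp_apply, fstF_boolPair, hW, sndF_boolPair, onesFn_eq_ones]
  have hij : iIJ (boolPair W (ones t)) = boolPair (ones (t / z.length)) (ones (t % z.length)) := by
    rw [iIJ, Function.comp_apply, fanoutFn_apply, hN, sndF_boolPair, divModFn_boolPair]
  have hz : sndF (fstF (boolPair W (ones t))) = z := by rw [fstF_boolPair, hW, sndF_boolPair]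
  have hzi : iZI (boolPair W (ones t)) = [z.getD (t / z.length) false] := by
    rw [iZI, Function.comp_apply, Function.comp_apply, fanoutFn_apply, Function.comp_apply, hij, fstF_boolPair,
      Function.comp_apply, hz, dropFn_boolPair, headBitFn_apply, List.length_replicate, CliqueNP.headD_drop]
  have hzj : iZJ (boolPair W (ones t)) = [z.getD (t % z.length) false] := by
    rw [iZJ, Function.comp_apply, Function.comp_apply, fanoutFn_apply, Function.comp_apply, hij, sndF_boolPair,
      Function.comp_apply, hz, dropFn_boolPair, headBitFn_apply, List.length_replicate, CliqueNP.headD_drop]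
  have hb : iB (boolPair W (ones t)) = [bits.getD t false] := by
    rw [iB, Function.comp_apply, Function.comp_apply, fanoutFn_apply, sndF_boolPair, Function.comp_apply,
      Function.comp_apply, fstF_boolPair, hW, fstF_boolPair, sndF_boolPair, bitAtFn_boolPair, headBitFn_apply,
      List.length_replicate, CliqueNP.headD_take_one_drop]
  rw [indPiece, notFn_apply (andFn_apply hzi (andFn_apply hzj hb))]
  rfl

/-- **Value of the independence test** on `⟨⟨nc, bits⟩, z⟩`. [folklore] -/
theorem indT_apply (nc bits z : List Bool) :
    indT (boolPair (boolPair nc bits) z) = [decide (∀ t < bits.length, indAtB bits z t = true)] := by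
  rw [indT, allIdxFn_apply oneBit_indPiece (length_sndF_fstF_le _)]
  refine congrArg (fun b => [b]) (Bool.decide_congr ?_)
  rw [Function.comp_apply, fstF_boolPair, sndF_boolPair]
  simp only [indPiece_apply, List.cons.injEq, and_true]

/-! ### The test language -/

/-- **The test** on `W = ⟨⟨nc, bits⟩, z⟩`: header, degree bound and independence. [cite: AroraBarak2009, Def. 17.2] -/
def testT (Δ : ℕ) : List Bool → List Bool := andFn CliqueNP.hdrT (andFn (degT Δ) indT)

/-- `testT Δ ∈ FP`. [cite: AroraBarak2009, §1.3] -/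
theorem testT_mem_FP (Δ : ℕ) : testT Δ ∈ FP :=
  andFn_mem_FP CliqueNP.hdrT_mem_FP (andFn_mem_FP (degT_mem_FP Δ) indT_mem_FP)

/-- `testT Δ` is one-bit. [folklore] -/
theorem oneBit_testT (Δ : ℕ) : OneBit (testT Δ) :=
  oneBit_andFn CliqueNP.oneBit_hdrT (oneBit_andFn (oneBit_degT Δ) oneBit_indT)

/-- **Value of the test** on `⟨⟨nc, bits⟩, z⟩`. [folklore] -/
theorem testT_apply (Δ : ℕ) (nc bits z : List Bool) :
    testT Δ (boolPair (boolPair nc bits) z) =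
      [decide (bits.length = bitsToNat nc * bitsToNat nc ∧
        ((∀ i < z.length, (rowOf z.length i bits).count true < Δ + 1) ∧ ∀ t < bits.length, indAtB bits z t = true))] := by
  have hh : CliqueNP.hdrT (boolPair (boolPair nc bits) z) = [decide (bits.length = bitsToNat nc * bitsToNat nc)] := by
    rw [CliqueNP.hdrT_apply]
    have hb : CliqueNP.bitsF (boolPair (boolPair nc bits) z) = bits := by
      rw [CliqueNP.bitsF, Function.comp_apply, fstF_boolPair, sndF_boolPair]
    have hd : CliqueNP.dimOf (boolPair (boolPair nc bits) z) = bitsToNat nc := by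
      rw [CliqueNP.dimOf, CliqueNP.ncF, Function.comp_apply, fstF_boolPair, fstF_boolPair]
    rw [hb, hd]
  rw [testT]
  exact CliqueNP.andFn_decide hh (CliqueNP.andFn_decide (degT_apply Δ nc bits z) (indT_apply nc bits z))

/-- **The test language** `testLang Δ = {W | testT Δ W = [1]}`. [cite: AroraBarak2009, Def. 17.2] -/
def testLang (Δ : ℕ) : Language Bool := {W | testT Δ W = [true]}

/-- **`testLang Δ ∈ P`.** [cite: AroraBarak2009, Def. 1.13 and §1.3] -/
theorem testLang_mem_P (Δ : ℕ) : testLang Δ ∈ Classes.P := CliqueNP.mem_P_of_oneBit (testT_mem_FP Δ) (oneBit_testT Δ)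

/-- A pair rejected by the header test is not in the test language. [folklore] -/
theorem not_mem_testLang_of_hdrT {Δ : ℕ} {y z : List Bool} (h : CliqueNP.hdrT (boolPair y z) = [false]) :
    boolPair y z ∉ testLang Δ := by
  intro hW
  change testT Δ (boolPair y z) = [true] at hW
  obtain ⟨b, hb⟩ := oneBit_andFn (oneBit_degT Δ) oneBit_indT (boolPair y z)
  rw [testT, andFn_apply h hb] at hW
  simp at hW

/-! ### Meaning of the test on the code of a graph -/

section Decode

open scoped Classical

variable {n : ℕ} (G : SimpleGraph (Fin n))

/-- **Row `i` of the adjacency bits is the adjacency vector of vertex `i`.** [folklore] -/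
theorem rowOf_adjBits (i : Fin n) :
    rowOf n i (CliqueNP.adjBits n G) = List.ofFn fun j : Fin n => decide (G.Adj i j) := by
  have hi : ((i : ℕ) + 1) * n ≤ n * n := Nat.mul_le_mul_right n (Nat.succ_le_of_lt i.isLt)
  have hlen : (rowOf n i (CliqueNP.adjBits n G)).length = n := by
    rw [rowOf, List.length_take, List.length_drop, CliqueNP.length_adjBits, Nat.succ_mul] at *
    omega
  refine List.ext_getElem (by rw [hlen, List.length_ofFn]) fun j h1 h2 => ?_
  have hj : j < n := by simpa using h2
  rw [List.getElem_ofFn]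
  unfold rowOf
  rw [List.getElem_take, List.getElem_drop, ← List.getD_eq_getElem _ false]
  exact CliqueNP.getD_adjBits_flat G i ⟨j, hj⟩

/-- **The number of ones in row `i` is the degree of `i`.** [folklore] -/
theorem count_rowOf_adjBits (i : Fin n) : (rowOf n i (CliqueNP.adjBits n G)).count true = G.degree i := by
  rw [rowOf_adjBits, CliqueNP.count_true_ofFn, ← SimpleGraph.card_neighborFinset_eq_degree,
    SimpleGraph.neighborFinset_eq_filter]
  congr 1
  ext j
  simp

/-- **The degree test decides `maxDegree ≤ Δ`.** [cite: AroraBarak2009, Def. 17.2] -/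
theorem degOK_iff (Δ : ℕ) :
    (∀ i < n, (rowOf n i (CliqueNP.adjBits n G)).count true < Δ + 1) ↔ G.maxDegree ≤ Δ := by
  constructor
  · intro h
    refine SimpleGraph.maxDegree_le_of_forall_degree_le _ _ fun v => ?_
    have := h v v.isLt
    rw [count_rowOf_adjBits] at this
    omega
  · intro h i hi
    have e := count_rowOf_adjBits G ⟨i, hi⟩
    dsimp only at e
    rw [e]
    have := G.degree_le_maxDegree ⟨i, hi⟩
    omega

/-- The vertex set chosen by a witness `z`: `S_z = {i | z i = 1}`. [cite: Karp1972, §3] -/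
def chosen (n : ℕ) (z : List Bool) : Finset (Fin n) := univ.filter fun i : Fin n => z.getD i false = true

/-- **The independence test holds at every flat index iff the chosen vertices are pairwise non-adjacent.**
[cite: Karp1972, §3] -/
theorem indOK_iff {z : List Bool} (hz : z.length = n) :
    (∀ t < n * n, indAtB (CliqueNP.adjBits n G) z t = true) ↔ G.IsIndepSet (↑(chosen n z) : Set (Fin n)) := by
  constructor
  · intro h i hi j hj _ hadj
    rw [Finset.mem_coe, chosen, Finset.mem_filter] at hi hj
    have ht := h _ (CliqueNP.flat_lt i j)
    unfold indAtB at ht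
    rw [hz, CliqueNP.flat_div, CliqueNP.flat_mod, CliqueNP.getD_adjBits_flat, hi.2, hj.2, decide_eq_true hadj] at ht
    simp at ht
  · intro h t ht
    unfold indAtB
    rw [hz, CliqueNP.getD_adjBits G ht]
    cases hi : z.getD (t / n) false
    · simp
    · cases hj : z.getD (t % n) false
      · simp
      · have hI : (⟨t / n, CliqueNP.div_lt_of_lt_mul ht⟩ : Fin n) ∈ (↑(chosen n z) : Set (Fin n)) := by
          rw [Finset.mem_coe, chosen, Finset.mem_filter]; exact ⟨mem_univ _, hi⟩
        have hJ : (⟨t % n, Nat.mod_lt _ (CliqueNP.pos_of_lt_mul ht)⟩ : Fin n) ∈ (↑(chosen n z) : Set (Fin n)) := by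
          rw [Finset.mem_coe, chosen, Finset.mem_filter]; exact ⟨mem_univ _, hj⟩
        by_cases hd : t / n = t % n
        · have : ¬ G.Adj ⟨t / n, CliqueNP.div_lt_of_lt_mul ht⟩ ⟨t % n, Nat.mod_lt _ (CliqueNP.pos_of_lt_mul ht)⟩ :=
            fun ha => G.ne_of_adj ha (Fin.ext hd)
          simp [this]
        · have hne : (⟨t / n, CliqueNP.div_lt_of_lt_mul ht⟩ : Fin n) ≠ ⟨t % n, Nat.mod_lt _ (CliqueNP.pos_of_lt_mul ht)⟩ :=
            fun e => hd (congrArg Fin.val e)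
          have := h hI hJ hne
          simp [this]

/-- **Meaning of the test on the code of a graph paired with a witness of length `n`**: maximum degree
`≤ Δ` and the chosen set is independent. [cite: AroraBarak2009, Def. 17.2] -/
theorem mem_testLang_encode_iff (Δ : ℕ) {z : List Bool} (hz : z.length = n) :
    boolPair (encodingGraph.encode ⟨n, G⟩) z ∈ testLang Δ ↔
      G.maxDegree ≤ Δ ∧ G.IsIndepSet (↑(chosen n z) : Set (Fin n)) := by
  change testT Δ _ = [true] ↔ _
  rw [encodingGraph_encode, CliqueNP.encodingGraphFin_encode_eq, testT_apply, hz]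
  simp only [List.cons.injEq, and_true, decide_eq_true_eq, bitsToNat_encodeNat, CliqueNP.length_adjBits, true_and]
  rw [degOK_iff, indOK_iff G hz]

end Decode

/-! ### The length functions of the counting assembly -/

/-- **The witness length** `gLen y = 1^{min ⟦nc⟧ |y|}` (`= 1ⁿ` on the code of a graph on `n` vertices). [folklore] -/
def gLen : List Bool → List Bool := binToUnaryFn ∘ fanoutFn id fstF
/-- On `W = ⟨y, z⟩`: `1^{#1(z)}` (the number of chosen vertices, in unary). [folklore] -/
def gP : List Bool → List Bool := binToUnaryFn ∘ fanoutFn sndF (popCountFn ∘ sndF)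
/-- On `W = ⟨y, z⟩`: `z ⇂ #1(z)`, a string of length `|z| - #1(z)` (the number of unchosen vertices). [folklore] -/
def gQ : List Bool → List Bool := dropFn ∘ fanoutFn gP sndF

/-- `gLen ∈ FP`. [folklore] -/
theorem gLen_mem_FP : gLen ∈ FP := comp_mem_FP binToUnaryFn_mem_FP (fanoutFn_mem_FP id_mem_FP fstF_mem_FP)
/-- `gP ∈ FP`. [folklore] -/
theorem gP_mem_FP : gP ∈ FP :=
  comp_mem_FP binToUnaryFn_mem_FP (fanoutFn_mem_FP sndF_mem_FP (comp_mem_FP popCountFn_mem_FP sndF_mem_FP))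
/-- `gQ ∈ FP`. [folklore] -/
theorem gQ_mem_FP : gQ ∈ FP := comp_mem_FP dropFn_mem_FP (fanoutFn_mem_FP gP_mem_FP sndF_mem_FP)

/-- `n ≤ |code ⟨n, G⟩|` (the bit field alone has `n²` symbols). [folklore] -/
theorem n_le_length_encode (n : ℕ) (G : SimpleGraph (Fin n)) : n ≤ (encodingGraph.encode ⟨n, G⟩).length := by
  rw [encodingGraph_encode, CliqueNP.encodingGraphFin_encode_eq, length_boolPair, CliqueNP.length_adjBits]
  rcases Nat.eq_zero_or_pos n with h0 | hpos
  · omega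
  · nlinarith

/-- **`gLen (code ⟨n, G⟩) = 1ⁿ`.** [folklore] -/
theorem gLen_encode (n : ℕ) (G : SimpleGraph (Fin n)) : gLen (encodingGraph.encode ⟨n, G⟩) = ones n := by
  rw [gLen, Function.comp_apply, fanoutFn_apply, id, binToUnaryFn_boolPair]
  have h1 : fstF (encodingGraph.encode ⟨n, G⟩) = encodeNat n := by rw [encodingGraph_encode, fstF_boolPair]
  rw [h1, bitsToNat_encodeNat, min_eq_left (n_le_length_encode n G)]

/-- **`|gP ⟨y, z⟩| = #1(z)`.** [folklore] -/
theorem length_gP (y z : List Bool) : (gP (boolPair y z)).length = z.count true := by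
  rw [gP, Function.comp_apply, fanoutFn_apply, sndF_boolPair, Function.comp_apply, sndF_boolPair, popCountFn_apply,
    binToUnaryFn_boolPair, bitsToNat_encodeNat, min_eq_left List.count_le_length, List.length_replicate]

/-- **`|gQ ⟨y, z⟩| = |z| - #1(z)`.** [folklore] -/
theorem length_gQ (y z : List Bool) : (gQ (boolPair y z)).length = z.length - z.count true := by
  rw [gQ, Function.comp_apply, fanoutFn_apply, sndF_boolPair, dropFn_boolPair, List.length_drop, length_gP]

/-- **`#1(z) = |S_z|`**: the number of ones of a witness of length `n` is the size of the chosen set. [folklore] -/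
theorem count_true_eq_card_chosen {n : ℕ} {z : List Bool} (hz : z.length = n) : z.count true = (chosen n z).card := by
  conv_lhs => rw [← CliqueNP.ofFn_getD hz]
  rw [CliqueNP.count_true_ofFn]
  rfl

end HardcoreSharpP

end Summit.PneNP.PneNP.Theorems

end
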